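/-
Copyright (c) 2026 the pub-hodgecm-mathlib formalisation cell (harness21).  Prover seat hodgecm-mathlib-F0P3a-p01 (g23), 2026-09-03.  E1 row 22b «SS EDGE LEVEL GROUP =
PRODUCT OF THE TWO VERTEX GROUPS ((U6)-lite, tree case)» (E1 keeper ∕ dealer F0P3a-p03 (g29) 00:46:50Z, on top of ★ row 22 `UnitaryLatticeTreeLevelGroups` (LH5-p04 (g9))).
-/
import Literature.NumberTheory.Automorphic.UnitaryLatticeTreeLevelGroups   -- ★ row 22: the level token, (U1) `exists_subgroup_mem_iff_mapGL_eq_and_map_sub_one_le_scaleLattice`, (U2) `map_sub_one_le_scaleLattice_pow_of_le`, (U3) `map_conj_eq_of_mem_iff_of_mapGL_eq`, (U4) edge nesting + stabiliser travel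
import HarnessLib

/-!
# The lattice graph of a hermitian space — THE SCHNEIDER–STUHLER LEVEL GROUP OF AN EDGE `U_F^{(e+1)} = U_M^{(e+1)} · U_{M′}^{(e+1)}` ((U6)-lite, tree case)

Topic `NumberTheory/Automorphic`; namespace `Literature.NumberTheory.Automorphic.UnitaryLatticeTree` (T1a currency of ★ `UnitaryLatticeTreeDefs`: `[Valued K ℤᵐ⁰]`, lattices
`M : Submodule 𝒪[K] (Fin N → K)`, `mapGL g M = g·M`, `scaleLattice c M = c·M`).  THEOREMS ONLY (no definition, no instance, no notation, no named fact, no `sorry`); any `N`,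
any valued field `K`.  Cell `pub/hodgecm-mathlib` (D-0151), crux H413 = `stmt-HodgeConjecture-24833`; E1 row 22b of the E1 BRICK LEDGER (keeper F0P3a-p03 (g29) 00:46:50Z:
«for `e ≥ 1` (written `e+1`) and an edge `ϖM ⊆ M′ ⊆ M`: (i) `U_M^{(e+1)} ≤ Stab(M′)`, `U_{M′}^{(e+1)} ≤ Stab(M)`; (ii) MUTUAL NORMALISATION `U_{M′}^{(e+1)} ≤ N(U_M^{(e+1)})` and
symmetrically; (iii) the product SET `U_M^{(e+1)} · U_{M′}^{(e+1)}` is a subgroup (`= U_M ⊔ U_{M′}`), packaged hypothesis-style; (iv) it lies in `P_F = Stab(M) ⊓ Stab(M′)`;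
(v) (U4)-compatibility `U_F^{(e+2)} ≤ U_M^{(e+1)}`»).  Seat F0P3a-p01 (g23).  HONEST LABEL: count-neutral generic base layer of the (R-SS) resolution engine (census E1 v1 §1–§2,
the facet groups `U_F^{(e)} = Π_{x ∈ F̄} U_x^{(e)}` [SS97 I.2] for the EDGE of the rank-one tree — the last (U)-object the complex needs below (U7)); HC_CM is proved only modulo the
2 remaining named inputs (hLiu418 24832, h413 24833) until rung 0 closes; nothing printed is asserted here — this is linear algebra over a valuation ring plus Mathlib's
`Subgroup.coe_mul_of_left_le_normalizer_right`.

LETTERS (all from ★ row 22, nothing new).  The level token is INLINE: `LEV(M, c, g) :≡ M.map ((Matrix.toLin' ((g : Matrix (Fin N) (Fin N) K) - 1)).restrictScalars 𝒪[K]) ≤ scaleLattice c M`;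
the vertex level groups are hypothesis-style subgroups `hU : ∀ g, g ∈ U ↔ mapGL g M = M ∧ LEV(M, ϖ^(e+1), g)` (on `M`) and `hU' : ∀ g, g ∈ U' ↔ mapGL g M′ = M′ ∧ LEV(M′, ϖ^(e+1), g)`
(on `M′`), objects supplied by ★ `exists_subgroup_mem_iff_mapGL_eq_and_map_sub_one_le_scaleLattice`; the edge is `(hM'M : M′ ≤ M) (hMM' : scaleLattice ϖ M ≤ M′)` (strictness never
needed); `(hϖ : ϖ ≠ 0) (hϖ1 : Valued.v ϖ ≤ 1)` where used.

* §1 (i) STABILISER TRAVEL AT LEVEL `≥ 1`: `mapGL_eq_of_mem_levelSubgroup_succ_of_edge` (`g ∈ U_M^{(e+1)} ⇒ g·M′ = M′`), `mapGL_eq_of_mem_levelSubgroup_succ_of_edge'`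
  (`g ∈ U_{M′}^{(e+1)} ⇒ g·M = M`); subgroup forms `levelSubgroup_succ_le_of_mem_iff_mapGL_eq_of_edge` ∕ `…'` against a hypothesis-style stabiliser `hP : ∀ g, g ∈ P ↔ mapGL g M′ = M′`.
* §2 (ii) MUTUAL NORMALISATION: `map_conj_levelSubgroup_eq_of_mem_of_edge` (`s ∈ U_{M′}^{(e+1)} ⇒ s U_M^{(e+1)} s⁻¹ = U_M^{(e+1)}`) and `…'` (symmetric);
  `levelSubgroup_le_normalizer_of_edge` (`U_{M′}^{(e+1)} ≤ N(U_M^{(e+1)})`) and `…'`.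
* §3 (iii) THE EDGE GROUP: `coe_sup_levelSubgroup_eq_mul_of_edge` (`↑(U_M ⊔ U_{M′}) = U_M * U_{M′}` as sets) and `coe_sup_levelSubgroup_eq_mul_of_edge'` (`= U_{M′} * U_M`);
  `mem_sup_levelSubgroup_iff_of_edge` (`g ∈ U_M ⊔ U_{M′} ↔ ∃ a b, a ∈ U_M ∧ b ∈ U_{M′} ∧ g = a * b`); the packaged object
  `exists_subgroup_mem_iff_exists_mul_of_edge` (`∃ U_F, ∀ g, g ∈ U_F ↔ ∃ a b, a ∈ U_M ∧ b ∈ U_{M′} ∧ g = a * b`).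
* §4 (iv)(v) WHERE THE EDGE GROUP SITS (hypothesis-style `hUF : ∀ g, g ∈ U_F ↔ ∃ a b, a ∈ U_M ∧ b ∈ U_{M′} ∧ g = a * b`): `sup_levelSubgroup_eq_of_mem_iff_exists_mul`
  (`U_M ⊔ U_{M′} = U_F`), `mapGL_eq_and_mapGL_eq_of_mem_edgeLevelSubgroup` (`U_F ≤ Stab(M) ⊓ Stab(M′) = P_F`), `edgeLevelSubgroup_le_levelSubgroup_of_edge` ∕ `…'`
  ((U4)-compatibility `U_F^{(e+1)} ≤ U_M^{(e)}` and `≤ U_{M′}^{(e)}` — at `e ↦ e+1` this is the keeper's (v) `U_M^{(e+2)} ⊔ U_{M′}^{(e+2)} ≤ U_M^{(e+1)}`),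
  `map_conj_edgeLevelSubgroup_eq_of_mapGL_eq` ((U3) for the edge: `P_F` normalises `U_F`).

## References
* [SchneiderStuhler1997] P. Schneider, U. Stuhler, *Representation theory and sheaves on the Bruhat–Tits building*, Publ. Math. IHÉS 85 (1997): Ch. I §2 (the groups `U_F^{(e)}`
  of a facet as the product of the vertex groups, properties (U1)–(U6)).
* [Korman2004] J. Korman, *On the local constancy of characters*, arXiv:math/0409292: §3.6 (the level groups in the lattice model; `U_F^{(e)} = Π_{x ∈ F̄} U_x^{(e)}`).
* [BruhatTits1972] F. Bruhat, J. Tits, *Groupes réductifs sur un corps local* I, Publ. Math. IHÉS 41 (1972): §10 (lattice description of the building of a classical group).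
-/

set_option autoImplicit false

noncomputable section

open scoped Valued WithZero Matrix MatrixGroups Pointwise

namespace Literature.NumberTheory.Automorphic.UnitaryLatticeTree

open Literature.NumberTheory.Automorphic Literature.NumberTheory.Automorphic.HermitianLattice

variable {K : Type*} [Field K] [Valued K ℤᵐ⁰] {N : ℕ}

/-! ## §1 (i) Stabiliser travel at level `≥ 1` along an edge `ϖM ⊆ M′ ⊆ M` -/

/-- **(i) `U_M^{(e+1)} ≤ Stab(M′)`**: a member of the level-`ϖ^{e+1}` group of `M` fixes the neighbour `M′` (`ϖM ⊆ M′ ⊆ M`, `|ϖ| ≤ 1`): its level on `M` is `≥ 1`, so it acts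
trivially on `M ∕ ϖM ⊇ M′ ∕ ϖM`. [cite: SchneiderStuhler1997, Ch. I §2 (U4)] [cite: BruhatTits1972, §10] -/
theorem mapGL_eq_of_mem_levelSubgroup_succ_of_edge {ϖ : K} (hϖ1 : Valued.v ϖ ≤ 1) {M M' : Submodule 𝒪[K] (Fin N → K)} (hM'M : M' ≤ M)
    (hMM' : scaleLattice ϖ M ≤ M') {e : ℕ} {U : Subgroup (GL (Fin N) K)}
    (hU : ∀ g : GL (Fin N) K, g ∈ U ↔ mapGL g M = M ∧ M.map ((Matrix.toLin' ((g : Matrix (Fin N) (Fin N) K) - 1)).restrictScalars 𝒪[K]) ≤ scaleLattice (ϖ ^ (e + 1)) M)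
    {g : GL (Fin N) K} (hg : g ∈ U) : mapGL g M' = M' := by
  obtain ⟨hg1, hg2⟩ := (hU g).1 hg
  have hg3 : M.map ((Matrix.toLin' ((g : Matrix (Fin N) (Fin N) K) - 1)).restrictScalars 𝒪[K]) ≤ scaleLattice ϖ M := by
    have := map_sub_one_le_scaleLattice_pow_of_le hϖ1 (Nat.succ_le_succ (Nat.zero_le e)) hg2
    rwa [pow_one] at this
  exact mapGL_eq_of_mapGL_eq_of_le_of_scaleLattice_le hM'M hMM' hg1 hg3

/-- **(i) `U_{M′}^{(e+1)} ≤ Stab(M)`**: a member of the level-`ϖ^{e+1}` group of `M′` fixes `M` (`ϖM ⊆ M′ ⊆ M`, `0 < |ϖ| ≤ 1`; ascend along the edge and unscale).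
[cite: SchneiderStuhler1997, Ch. I §2 (U4)] [cite: BruhatTits1972, §10] -/
theorem mapGL_eq_of_mem_levelSubgroup_succ_of_edge' {ϖ : K} (hϖ : ϖ ≠ 0) (hϖ1 : Valued.v ϖ ≤ 1) {M M' : Submodule 𝒪[K] (Fin N → K)} (hM'M : M' ≤ M)
    (hMM' : scaleLattice ϖ M ≤ M') {e : ℕ} {U' : Subgroup (GL (Fin N) K)}
    (hU' : ∀ g : GL (Fin N) K, g ∈ U' ↔ mapGL g M' = M' ∧ M'.map ((Matrix.toLin' ((g : Matrix (Fin N) (Fin N) K) - 1)).restrictScalars 𝒪[K]) ≤ scaleLattice (ϖ ^ (e + 1)) M')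
    {g : GL (Fin N) K} (hg : g ∈ U') : mapGL g M = M := by
  obtain ⟨hg1, hg2⟩ := (hU' g).1 hg
  have hg3 : M'.map ((Matrix.toLin' ((g : Matrix (Fin N) (Fin N) K) - 1)).restrictScalars 𝒪[K]) ≤ scaleLattice ϖ M' := by
    have := map_sub_one_le_scaleLattice_pow_of_le hϖ1 (Nat.succ_le_succ (Nat.zero_le e)) hg2
    rwa [pow_one] at this
  exact mapGL_eq_of_mapGL_eq_of_le_of_scaleLattice_le' hϖ hM'M hMM' hg1 hg3

/-- **(i) SUBGROUP FORM `U_M^{(e+1)} ≤ P_{M′}`** against a hypothesis-style stabiliser `g ∈ P ↔ g·M′ = M′`. [cite: SchneiderStuhler1997, Ch. I §2 (U4)] [cite: BruhatTits1972, §10] -/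
theorem levelSubgroup_succ_le_of_mem_iff_mapGL_eq_of_edge {ϖ : K} (hϖ1 : Valued.v ϖ ≤ 1) {M M' : Submodule 𝒪[K] (Fin N → K)} (hM'M : M' ≤ M)
    (hMM' : scaleLattice ϖ M ≤ M') {e : ℕ} {U P : Subgroup (GL (Fin N) K)}
    (hU : ∀ g : GL (Fin N) K, g ∈ U ↔ mapGL g M = M ∧ M.map ((Matrix.toLin' ((g : Matrix (Fin N) (Fin N) K) - 1)).restrictScalars 𝒪[K]) ≤ scaleLattice (ϖ ^ (e + 1)) M)
    (hP : ∀ g : GL (Fin N) K, g ∈ P ↔ mapGL g M' = M') : U ≤ P :=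
  fun _ hg => (hP _).2 (mapGL_eq_of_mem_levelSubgroup_succ_of_edge hϖ1 hM'M hMM' hU hg)

/-- **(i) SUBGROUP FORM `U_{M′}^{(e+1)} ≤ P_M`** against a hypothesis-style stabiliser `g ∈ P ↔ g·M = M`. [cite: SchneiderStuhler1997, Ch. I §2 (U4)] [cite: BruhatTits1972, §10] -/
theorem levelSubgroup_succ_le_of_mem_iff_mapGL_eq_of_edge' {ϖ : K} (hϖ : ϖ ≠ 0) (hϖ1 : Valued.v ϖ ≤ 1) {M M' : Submodule 𝒪[K] (Fin N → K)} (hM'M : M' ≤ M)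
    (hMM' : scaleLattice ϖ M ≤ M') {e : ℕ} {U' P : Subgroup (GL (Fin N) K)}
    (hU' : ∀ g : GL (Fin N) K, g ∈ U' ↔ mapGL g M' = M' ∧ M'.map ((Matrix.toLin' ((g : Matrix (Fin N) (Fin N) K) - 1)).restrictScalars 𝒪[K]) ≤ scaleLattice (ϖ ^ (e + 1)) M')
    (hP : ∀ g : GL (Fin N) K, g ∈ P ↔ mapGL g M = M) : U' ≤ P :=
  fun _ hg => (hP _).2 (mapGL_eq_of_mem_levelSubgroup_succ_of_edge' hϖ hϖ1 hM'M hMM' hU' hg)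

/-! ## §2 (ii) Mutual normalisation of the two vertex groups of an edge -/

/-- **(ii) `U_{M′}^{(e+1)}` NORMALISES `U_M^{(e+1)}`**: for `s ∈ U_{M′}^{(e+1)}`, `s U_M^{(e+1)} s⁻¹ = U_M^{(e+1)}` — `s` fixes `M` by (i), and `Stab(M)` normalises `U_M` by (U3).
[cite: SchneiderStuhler1997, Ch. I §2 (U3)–(U4)] [cite: Korman2004, §3.6] -/
theorem map_conj_levelSubgroup_eq_of_mem_of_edge {ϖ : K} (hϖ : ϖ ≠ 0) (hϖ1 : Valued.v ϖ ≤ 1) {M M' : Submodule 𝒪[K] (Fin N → K)} (hM'M : M' ≤ M)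
    (hMM' : scaleLattice ϖ M ≤ M') {e : ℕ} {U U' : Subgroup (GL (Fin N) K)}
    (hU : ∀ g : GL (Fin N) K, g ∈ U ↔ mapGL g M = M ∧ M.map ((Matrix.toLin' ((g : Matrix (Fin N) (Fin N) K) - 1)).restrictScalars 𝒪[K]) ≤ scaleLattice (ϖ ^ (e + 1)) M)
    (hU' : ∀ g : GL (Fin N) K, g ∈ U' ↔ mapGL g M' = M' ∧ M'.map ((Matrix.toLin' ((g : Matrix (Fin N) (Fin N) K) - 1)).restrictScalars 𝒪[K]) ≤ scaleLattice (ϖ ^ (e + 1)) M')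
    {s : GL (Fin N) K} (hs : s ∈ U') : U.map (MulAut.conj s).toMonoidHom = U :=
  map_conj_eq_of_mem_iff_of_mapGL_eq hU (mapGL_eq_of_mem_levelSubgroup_succ_of_edge' hϖ hϖ1 hM'M hMM' hU' hs)

/-- **(ii) `U_M^{(e+1)}` NORMALISES `U_{M′}^{(e+1)}`**: for `s ∈ U_M^{(e+1)}`, `s U_{M′}^{(e+1)} s⁻¹ = U_{M′}^{(e+1)}` — `s` fixes `M′` by (i), and `Stab(M′)` normalises `U_{M′}` by (U3).
[cite: SchneiderStuhler1997, Ch. I §2 (U3)–(U4)] [cite: Korman2004, §3.6] -/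
theorem map_conj_levelSubgroup_eq_of_mem_of_edge' {ϖ : K} (hϖ1 : Valued.v ϖ ≤ 1) {M M' : Submodule 𝒪[K] (Fin N → K)} (hM'M : M' ≤ M)
    (hMM' : scaleLattice ϖ M ≤ M') {e : ℕ} {U U' : Subgroup (GL (Fin N) K)}
    (hU : ∀ g : GL (Fin N) K, g ∈ U ↔ mapGL g M = M ∧ M.map ((Matrix.toLin' ((g : Matrix (Fin N) (Fin N) K) - 1)).restrictScalars 𝒪[K]) ≤ scaleLattice (ϖ ^ (e + 1)) M)
    (hU' : ∀ g : GL (Fin N) K, g ∈ U' ↔ mapGL g M' = M' ∧ M'.map ((Matrix.toLin' ((g : Matrix (Fin N) (Fin N) K) - 1)).restrictScalars 𝒪[K]) ≤ scaleLattice (ϖ ^ (e + 1)) M')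
    {s : GL (Fin N) K} (hs : s ∈ U) : U'.map (MulAut.conj s).toMonoidHom = U' :=
  map_conj_eq_of_mem_iff_of_mapGL_eq hU' (mapGL_eq_of_mem_levelSubgroup_succ_of_edge hϖ1 hM'M hMM' hU hs)

/-- **(ii) `U_{M′}^{(e+1)} ≤ N(U_M^{(e+1)})`** (Mathlib's `Subgroup.normalizer`). [cite: SchneiderStuhler1997, Ch. I §2 (U3)–(U4)] [cite: Korman2004, §3.6] -/
theorem levelSubgroup_le_normalizer_of_edge {ϖ : K} (hϖ : ϖ ≠ 0) (hϖ1 : Valued.v ϖ ≤ 1) {M M' : Submodule 𝒪[K] (Fin N → K)} (hM'M : M' ≤ M)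
    (hMM' : scaleLattice ϖ M ≤ M') {e : ℕ} {U U' : Subgroup (GL (Fin N) K)}
    (hU : ∀ g : GL (Fin N) K, g ∈ U ↔ mapGL g M = M ∧ M.map ((Matrix.toLin' ((g : Matrix (Fin N) (Fin N) K) - 1)).restrictScalars 𝒪[K]) ≤ scaleLattice (ϖ ^ (e + 1)) M)
    (hU' : ∀ g : GL (Fin N) K, g ∈ U' ↔ mapGL g M' = M' ∧ M'.map ((Matrix.toLin' ((g : Matrix (Fin N) (Fin N) K) - 1)).restrictScalars 𝒪[K]) ≤ scaleLattice (ϖ ^ (e + 1)) M') :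
    U' ≤ Subgroup.normalizer (U : Set (GL (Fin N) K)) := by
  intro s hs
  rw [Subgroup.mem_normalizer_iff_map_conj_eq]
  exact map_conj_levelSubgroup_eq_of_mem_of_edge hϖ hϖ1 hM'M hMM' hU hU' hs

/-- **(ii) `U_M^{(e+1)} ≤ N(U_{M′}^{(e+1)})`**. [cite: SchneiderStuhler1997, Ch. I §2 (U3)–(U4)] [cite: Korman2004, §3.6] -/
theorem levelSubgroup_le_normalizer_of_edge' {ϖ : K} (hϖ1 : Valued.v ϖ ≤ 1) {M M' : Submodule 𝒪[K] (Fin N → K)} (hM'M : M' ≤ M)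
    (hMM' : scaleLattice ϖ M ≤ M') {e : ℕ} {U U' : Subgroup (GL (Fin N) K)}
    (hU : ∀ g : GL (Fin N) K, g ∈ U ↔ mapGL g M = M ∧ M.map ((Matrix.toLin' ((g : Matrix (Fin N) (Fin N) K) - 1)).restrictScalars 𝒪[K]) ≤ scaleLattice (ϖ ^ (e + 1)) M)
    (hU' : ∀ g : GL (Fin N) K, g ∈ U' ↔ mapGL g M' = M' ∧ M'.map ((Matrix.toLin' ((g : Matrix (Fin N) (Fin N) K) - 1)).restrictScalars 𝒪[K]) ≤ scaleLattice (ϖ ^ (e + 1)) M') :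
    U ≤ Subgroup.normalizer (U' : Set (GL (Fin N) K)) := by
  intro s hs
  rw [Subgroup.mem_normalizer_iff_map_conj_eq]
  exact map_conj_levelSubgroup_eq_of_mem_of_edge' hϖ1 hM'M hMM' hU hU' hs

/-! ## §3 (iii) The edge group `U_F^{(e+1)} = U_M^{(e+1)} · U_{M′}^{(e+1)}` is a subgroup -/

/-- **(iii) THE PRODUCT SET IS THE JOIN**: `↑(U_M^{(e+1)} ⊔ U_{M′}^{(e+1)}) = U_M^{(e+1)} * U_{M′}^{(e+1)}` (pointwise product of sets) — Mathlib's
`Subgroup.coe_mul_of_right_le_normalizer_left` fed with (ii). [cite: SchneiderStuhler1997, Ch. I §2 (U6)] [cite: Korman2004, §3.6] -/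
theorem coe_sup_levelSubgroup_eq_mul_of_edge {ϖ : K} (hϖ : ϖ ≠ 0) (hϖ1 : Valued.v ϖ ≤ 1) {M M' : Submodule 𝒪[K] (Fin N → K)} (hM'M : M' ≤ M)
    (hMM' : scaleLattice ϖ M ≤ M') {e : ℕ} {U U' : Subgroup (GL (Fin N) K)}
    (hU : ∀ g : GL (Fin N) K, g ∈ U ↔ mapGL g M = M ∧ M.map ((Matrix.toLin' ((g : Matrix (Fin N) (Fin N) K) - 1)).restrictScalars 𝒪[K]) ≤ scaleLattice (ϖ ^ (e + 1)) M)
    (hU' : ∀ g : GL (Fin N) K, g ∈ U' ↔ mapGL g M' = M' ∧ M'.map ((Matrix.toLin' ((g : Matrix (Fin N) (Fin N) K) - 1)).restrictScalars 𝒪[K]) ≤ scaleLattice (ϖ ^ (e + 1)) M') :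
    ((U ⊔ U' : Subgroup (GL (Fin N) K)) : Set (GL (Fin N) K)) = (U : Set (GL (Fin N) K)) * (U' : Set (GL (Fin N) K)) :=
  Subgroup.coe_mul_of_right_le_normalizer_left U U' (levelSubgroup_le_normalizer_of_edge hϖ hϖ1 hM'M hMM' hU hU')

/-- **(iii) … IN EITHER ORDER**: `↑(U_M^{(e+1)} ⊔ U_{M′}^{(e+1)}) = U_{M′}^{(e+1)} * U_M^{(e+1)}`. [cite: SchneiderStuhler1997, Ch. I §2 (U6)] [cite: Korman2004, §3.6] -/
theorem coe_sup_levelSubgroup_eq_mul_of_edge' {ϖ : K} (hϖ1 : Valued.v ϖ ≤ 1) {M M' : Submodule 𝒪[K] (Fin N → K)} (hM'M : M' ≤ M)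
    (hMM' : scaleLattice ϖ M ≤ M') {e : ℕ} {U U' : Subgroup (GL (Fin N) K)}
    (hU : ∀ g : GL (Fin N) K, g ∈ U ↔ mapGL g M = M ∧ M.map ((Matrix.toLin' ((g : Matrix (Fin N) (Fin N) K) - 1)).restrictScalars 𝒪[K]) ≤ scaleLattice (ϖ ^ (e + 1)) M)
    (hU' : ∀ g : GL (Fin N) K, g ∈ U' ↔ mapGL g M' = M' ∧ M'.map ((Matrix.toLin' ((g : Matrix (Fin N) (Fin N) K) - 1)).restrictScalars 𝒪[K]) ≤ scaleLattice (ϖ ^ (e + 1)) M') :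
    ((U ⊔ U' : Subgroup (GL (Fin N) K)) : Set (GL (Fin N) K)) = (U' : Set (GL (Fin N) K)) * (U : Set (GL (Fin N) K)) := by
  rw [sup_comm]
  exact Subgroup.coe_mul_of_right_le_normalizer_left U' U (levelSubgroup_le_normalizer_of_edge' hϖ1 hM'M hMM' hU hU')

/-- **(iii) MEMBERSHIP IN THE EDGE GROUP**: `g ∈ U_M^{(e+1)} ⊔ U_{M′}^{(e+1)} ↔ g = a * b` with `a ∈ U_M^{(e+1)}`, `b ∈ U_{M′}^{(e+1)}`. [cite: SchneiderStuhler1997, Ch. I §2 (U6)]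
[cite: Korman2004, §3.6] -/
theorem mem_sup_levelSubgroup_iff_of_edge {ϖ : K} (hϖ : ϖ ≠ 0) (hϖ1 : Valued.v ϖ ≤ 1) {M M' : Submodule 𝒪[K] (Fin N → K)} (hM'M : M' ≤ M)
    (hMM' : scaleLattice ϖ M ≤ M') {e : ℕ} {U U' : Subgroup (GL (Fin N) K)}
    (hU : ∀ g : GL (Fin N) K, g ∈ U ↔ mapGL g M = M ∧ M.map ((Matrix.toLin' ((g : Matrix (Fin N) (Fin N) K) - 1)).restrictScalars 𝒪[K]) ≤ scaleLattice (ϖ ^ (e + 1)) M)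
    (hU' : ∀ g : GL (Fin N) K, g ∈ U' ↔ mapGL g M' = M' ∧ M'.map ((Matrix.toLin' ((g : Matrix (Fin N) (Fin N) K) - 1)).restrictScalars 𝒪[K]) ≤ scaleLattice (ϖ ^ (e + 1)) M')
    (g : GL (Fin N) K) : g ∈ U ⊔ U' ↔ ∃ a b : GL (Fin N) K, a ∈ U ∧ b ∈ U' ∧ g = a * b := by
  rw [← SetLike.mem_coe, coe_sup_levelSubgroup_eq_mul_of_edge hϖ hϖ1 hM'M hMM' hU hU', Set.mem_mul]
  constructor
  · rintro ⟨a, ha, b, hb, rfl⟩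
    exact ⟨a, b, ha, hb, rfl⟩
  · rintro ⟨a, b, ha, hb, rfl⟩
    exact ⟨a, ha, b, hb, rfl⟩

/-- **(iii) THE EDGE GROUP AS AN OBJECT** (the tree's hypothesis style): there is `U_F ≤ GL_N(K)` with `g ∈ U_F ↔ ∃ a b, a ∈ U_M^{(e+1)} ∧ b ∈ U_{M′}^{(e+1)} ∧ g = a * b`.
[cite: SchneiderStuhler1997, Ch. I §2 (U6)] [cite: Korman2004, §3.6] -/
theorem exists_subgroup_mem_iff_exists_mul_of_edge {ϖ : K} (hϖ : ϖ ≠ 0) (hϖ1 : Valued.v ϖ ≤ 1) {M M' : Submodule 𝒪[K] (Fin N → K)} (hM'M : M' ≤ M)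
    (hMM' : scaleLattice ϖ M ≤ M') {e : ℕ} {U U' : Subgroup (GL (Fin N) K)}
    (hU : ∀ g : GL (Fin N) K, g ∈ U ↔ mapGL g M = M ∧ M.map ((Matrix.toLin' ((g : Matrix (Fin N) (Fin N) K) - 1)).restrictScalars 𝒪[K]) ≤ scaleLattice (ϖ ^ (e + 1)) M)
    (hU' : ∀ g : GL (Fin N) K, g ∈ U' ↔ mapGL g M' = M' ∧ M'.map ((Matrix.toLin' ((g : Matrix (Fin N) (Fin N) K) - 1)).restrictScalars 𝒪[K]) ≤ scaleLattice (ϖ ^ (e + 1)) M') :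
    ∃ UF : Subgroup (GL (Fin N) K), ∀ g : GL (Fin N) K, g ∈ UF ↔ ∃ a b : GL (Fin N) K, a ∈ U ∧ b ∈ U' ∧ g = a * b :=
  ⟨U ⊔ U', mem_sup_levelSubgroup_iff_of_edge hϖ hϖ1 hM'M hMM' hU hU'⟩

/-! ## §4 (iv)(v) Where the edge group sits: `U_F = U_M ⊔ U_{M′} ≤ P_F`, (U4)-compatibility, (U3) for the edge -/

/-- **THE HYPOTHESIS-STYLE EDGE GROUP IS THE JOIN**: if `g ∈ U_F ↔ ∃ a b, a ∈ U_M^{(e+1)} ∧ b ∈ U_{M′}^{(e+1)} ∧ g = a * b` then `U_M ⊔ U_{M′} = U_F`.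
[cite: SchneiderStuhler1997, Ch. I §2 (U6)] [cite: Korman2004, §3.6] -/
theorem sup_levelSubgroup_eq_of_mem_iff_exists_mul {ϖ : K} (hϖ : ϖ ≠ 0) (hϖ1 : Valued.v ϖ ≤ 1) {M M' : Submodule 𝒪[K] (Fin N → K)} (hM'M : M' ≤ M)
    (hMM' : scaleLattice ϖ M ≤ M') {e : ℕ} {U U' UF : Subgroup (GL (Fin N) K)}
    (hU : ∀ g : GL (Fin N) K, g ∈ U ↔ mapGL g M = M ∧ M.map ((Matrix.toLin' ((g : Matrix (Fin N) (Fin N) K) - 1)).restrictScalars 𝒪[K]) ≤ scaleLattice (ϖ ^ (e + 1)) M)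
    (hU' : ∀ g : GL (Fin N) K, g ∈ U' ↔ mapGL g M' = M' ∧ M'.map ((Matrix.toLin' ((g : Matrix (Fin N) (Fin N) K) - 1)).restrictScalars 𝒪[K]) ≤ scaleLattice (ϖ ^ (e + 1)) M')
    (hUF : ∀ g : GL (Fin N) K, g ∈ UF ↔ ∃ a b : GL (Fin N) K, a ∈ U ∧ b ∈ U' ∧ g = a * b) : U ⊔ U' = UF := by
  ext g
  rw [mem_sup_levelSubgroup_iff_of_edge hϖ hϖ1 hM'M hMM' hU hU', hUF]

/-- **(iv) `U_F^{(e+1)} ≤ P_F = Stab(M) ⊓ Stab(M′)`**: every product `a * b` (`a ∈ U_M^{(e+1)}`, `b ∈ U_{M′}^{(e+1)}`) fixes both `M` and `M′`.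
[cite: SchneiderStuhler1997, Ch. I §2 (U1), (U4)] [cite: BruhatTits1972, §10] -/
theorem mapGL_eq_and_mapGL_eq_of_mem_edgeLevelSubgroup {ϖ : K} (hϖ : ϖ ≠ 0) (hϖ1 : Valued.v ϖ ≤ 1) {M M' : Submodule 𝒪[K] (Fin N → K)} (hM'M : M' ≤ M)
    (hMM' : scaleLattice ϖ M ≤ M') {e : ℕ} {U U' UF : Subgroup (GL (Fin N) K)}
    (hU : ∀ g : GL (Fin N) K, g ∈ U ↔ mapGL g M = M ∧ M.map ((Matrix.toLin' ((g : Matrix (Fin N) (Fin N) K) - 1)).restrictScalars 𝒪[K]) ≤ scaleLattice (ϖ ^ (e + 1)) M)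
    (hU' : ∀ g : GL (Fin N) K, g ∈ U' ↔ mapGL g M' = M' ∧ M'.map ((Matrix.toLin' ((g : Matrix (Fin N) (Fin N) K) - 1)).restrictScalars 𝒪[K]) ≤ scaleLattice (ϖ ^ (e + 1)) M')
    (hUF : ∀ g : GL (Fin N) K, g ∈ UF ↔ ∃ a b : GL (Fin N) K, a ∈ U ∧ b ∈ U' ∧ g = a * b)
    {g : GL (Fin N) K} (hg : g ∈ UF) : mapGL g M = M ∧ mapGL g M' = M' := by
  obtain ⟨a, b, ha, hb, rfl⟩ := (hUF g).1 hg
  refine ⟨?_, ?_⟩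
  · rw [mapGL_mul, mapGL_eq_of_mem_levelSubgroup_succ_of_edge' hϖ hϖ1 hM'M hMM' hU' hb, ((hU a).1 ha).1]
  · rw [mapGL_mul, ((hU' b).1 hb).1, mapGL_eq_of_mem_levelSubgroup_succ_of_edge hϖ1 hM'M hMM' hU ha]

/-- **(v) (U4)-COMPATIBILITY ON THE `M` SIDE**: `U_M^{(e+1)} ⊔ U_{M′}^{(e+1)} ≤ U_M^{(e)}` (the first factor by (U2), the second by (U4)); at `e ↦ e+1` this is
`U_F^{(e+2)} ≤ U_M^{(e+1)}`. [cite: SchneiderStuhler1997, Ch. I §2 (U2), (U4)] [cite: Korman2004, §3.6] -/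
theorem sup_levelSubgroup_succ_le_levelSubgroup_of_edge {ϖ : K} (hϖ : ϖ ≠ 0) (hϖ1 : Valued.v ϖ ≤ 1) {M M' : Submodule 𝒪[K] (Fin N → K)} (hM'M : M' ≤ M)
    (hMM' : scaleLattice ϖ M ≤ M') {e : ℕ} {U U' V : Subgroup (GL (Fin N) K)}
    (hU : ∀ g : GL (Fin N) K, g ∈ U ↔ mapGL g M = M ∧ M.map ((Matrix.toLin' ((g : Matrix (Fin N) (Fin N) K) - 1)).restrictScalars 𝒪[K]) ≤ scaleLattice (ϖ ^ (e + 1)) M)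
    (hU' : ∀ g : GL (Fin N) K, g ∈ U' ↔ mapGL g M' = M' ∧ M'.map ((Matrix.toLin' ((g : Matrix (Fin N) (Fin N) K) - 1)).restrictScalars 𝒪[K]) ≤ scaleLattice (ϖ ^ (e + 1)) M')
    (hV : ∀ g : GL (Fin N) K, g ∈ V ↔ mapGL g M = M ∧ M.map ((Matrix.toLin' ((g : Matrix (Fin N) (Fin N) K) - 1)).restrictScalars 𝒪[K]) ≤ scaleLattice (ϖ ^ e) M) :
    U ⊔ U' ≤ V :=
  sup_le (subgroup_le_of_mem_iff_of_le hϖ1 (Nat.le_succ e) hV hU) (subgroup_le_of_mem_iff_succ_of_le_of_scaleLattice_le' hϖ hϖ1 hM'M hMM' hU' hV)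

/-- **(v) (U4)-COMPATIBILITY ON THE `M′` SIDE**: `U_M^{(e+1)} ⊔ U_{M′}^{(e+1)} ≤ U_{M′}^{(e)}`. [cite: SchneiderStuhler1997, Ch. I §2 (U2), (U4)] [cite: Korman2004, §3.6] -/
theorem sup_levelSubgroup_succ_le_levelSubgroup_of_edge' {ϖ : K} (hϖ1 : Valued.v ϖ ≤ 1) {M M' : Submodule 𝒪[K] (Fin N → K)} (hM'M : M' ≤ M)
    (hMM' : scaleLattice ϖ M ≤ M') {e : ℕ} {U U' V' : Subgroup (GL (Fin N) K)}
    (hU : ∀ g : GL (Fin N) K, g ∈ U ↔ mapGL g M = M ∧ M.map ((Matrix.toLin' ((g : Matrix (Fin N) (Fin N) K) - 1)).restrictScalars 𝒪[K]) ≤ scaleLattice (ϖ ^ (e + 1)) M)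
    (hU' : ∀ g : GL (Fin N) K, g ∈ U' ↔ mapGL g M' = M' ∧ M'.map ((Matrix.toLin' ((g : Matrix (Fin N) (Fin N) K) - 1)).restrictScalars 𝒪[K]) ≤ scaleLattice (ϖ ^ (e + 1)) M')
    (hV' : ∀ g : GL (Fin N) K, g ∈ V' ↔ mapGL g M' = M' ∧ M'.map ((Matrix.toLin' ((g : Matrix (Fin N) (Fin N) K) - 1)).restrictScalars 𝒪[K]) ≤ scaleLattice (ϖ ^ e) M') :
    U ⊔ U' ≤ V' :=
  sup_le (subgroup_le_of_mem_iff_succ_of_le_of_scaleLattice_le hϖ1 hM'M hMM' hU hV') (subgroup_le_of_mem_iff_of_le hϖ1 (Nat.le_succ e) hV' hU')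

/-- **(v) THE EDGE GROUPS ARE ANTITONE IN `e`**: `U_M^{(e′+1)} ⊔ U_{M′}^{(e′+1)} ≤ U_M^{(e+1)} ⊔ U_{M′}^{(e+1)}` for `e ≤ e′` ((U2) factor by factor).
[cite: SchneiderStuhler1997, Ch. I §2 (U2)] [cite: Korman2004, §3.6] -/
theorem sup_levelSubgroup_mono_of_le {ϖ : K} (hϖ1 : Valued.v ϖ ≤ 1) {M M' : Submodule 𝒪[K] (Fin N → K)} {e e' : ℕ} (hee' : e ≤ e')
    {U U' W W' : Subgroup (GL (Fin N) K)}
    (hU : ∀ g : GL (Fin N) K, g ∈ U ↔ mapGL g M = M ∧ M.map ((Matrix.toLin' ((g : Matrix (Fin N) (Fin N) K) - 1)).restrictScalars 𝒪[K]) ≤ scaleLattice (ϖ ^ (e + 1)) M)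
    (hU' : ∀ g : GL (Fin N) K, g ∈ U' ↔ mapGL g M' = M' ∧ M'.map ((Matrix.toLin' ((g : Matrix (Fin N) (Fin N) K) - 1)).restrictScalars 𝒪[K]) ≤ scaleLattice (ϖ ^ (e + 1)) M')
    (hW : ∀ g : GL (Fin N) K, g ∈ W ↔ mapGL g M = M ∧ M.map ((Matrix.toLin' ((g : Matrix (Fin N) (Fin N) K) - 1)).restrictScalars 𝒪[K]) ≤ scaleLattice (ϖ ^ (e' + 1)) M)
    (hW' : ∀ g : GL (Fin N) K, g ∈ W' ↔ mapGL g M' = M' ∧ M'.map ((Matrix.toLin' ((g : Matrix (Fin N) (Fin N) K) - 1)).restrictScalars 𝒪[K]) ≤ scaleLattice (ϖ ^ (e' + 1)) M') :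
    W ⊔ W' ≤ U ⊔ U' :=
  sup_le_sup (subgroup_le_of_mem_iff_of_le hϖ1 (Nat.succ_le_succ hee') hU hW) (subgroup_le_of_mem_iff_of_le hϖ1 (Nat.succ_le_succ hee') hU' hW')

/-- **(U3) FOR THE EDGE: `P_F` NORMALISES `U_F`**: if `s·M = M` and `s·M′ = M′` then `s (U_M ⊔ U_{M′}) s⁻¹ = U_M ⊔ U_{M′}` (★ (U3) on each factor, `Subgroup.map_sup`).
[cite: SchneiderStuhler1997, Ch. I §2 (U3)] [cite: BruhatTits1972, §10] -/
theorem map_conj_sup_levelSubgroup_eq_of_mapGL_eq {c c' : K} {M M' : Submodule 𝒪[K] (Fin N → K)} {U U' : Subgroup (GL (Fin N) K)}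
    (hU : ∀ g : GL (Fin N) K, g ∈ U ↔ mapGL g M = M ∧ M.map ((Matrix.toLin' ((g : Matrix (Fin N) (Fin N) K) - 1)).restrictScalars 𝒪[K]) ≤ scaleLattice c M)
    (hU' : ∀ g : GL (Fin N) K, g ∈ U' ↔ mapGL g M' = M' ∧ M'.map ((Matrix.toLin' ((g : Matrix (Fin N) (Fin N) K) - 1)).restrictScalars 𝒪[K]) ≤ scaleLattice c' M')
    {s : GL (Fin N) K} (hs : mapGL s M = M) (hs' : mapGL s M' = M') : (U ⊔ U').map (MulAut.conj s).toMonoidHom = U ⊔ U' := by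
  rw [Subgroup.map_sup, map_conj_eq_of_mem_iff_of_mapGL_eq hU hs, map_conj_eq_of_mem_iff_of_mapGL_eq hU' hs']

/-- **(U3) FOR THE EDGE, MEMBERSHIP FORM**: `P_F = Stab(M) ⊓ Stab(M′) ≤ N(U_M ⊔ U_{M′})` against hypothesis-style stabilisers. [cite: SchneiderStuhler1997, Ch. I §2 (U3)]
[cite: BruhatTits1972, §10] -/
theorem le_normalizer_sup_levelSubgroup_of_mem_iff_mapGL_eq {c c' : K} {M M' : Submodule 𝒪[K] (Fin N → K)} {U U' P P' : Subgroup (GL (Fin N) K)}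
    (hU : ∀ g : GL (Fin N) K, g ∈ U ↔ mapGL g M = M ∧ M.map ((Matrix.toLin' ((g : Matrix (Fin N) (Fin N) K) - 1)).restrictScalars 𝒪[K]) ≤ scaleLattice c M)
    (hU' : ∀ g : GL (Fin N) K, g ∈ U' ↔ mapGL g M' = M' ∧ M'.map ((Matrix.toLin' ((g : Matrix (Fin N) (Fin N) K) - 1)).restrictScalars 𝒪[K]) ≤ scaleLattice c' M')
    (hP : ∀ g : GL (Fin N) K, g ∈ P ↔ mapGL g M = M) (hP' : ∀ g : GL (Fin N) K, g ∈ P' ↔ mapGL g M' = M') :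
    P ⊓ P' ≤ Subgroup.normalizer ((U ⊔ U' : Subgroup (GL (Fin N) K)) : Set (GL (Fin N) K)) := by
  intro s hs
  rw [Subgroup.mem_inf] at hs
  rw [Subgroup.mem_normalizer_iff_map_conj_eq]
  exact map_conj_sup_levelSubgroup_eq_of_mapGL_eq hU hU' ((hP s).1 hs.1) ((hP' s).1 hs.2)

end Literature.NumberTheory.Automorphic.UnitaryLatticeTree

end
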